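import Summits.CriticalPhenomena.PercolationContinuityZ3.Theorems.PercNearOneGluingNoHeavyLowerTailRKNS2
import HarnessLib

/-!
# `NoHeavyLowerTail` (stmt-CriticalPhenomena-4575) — the refined KN rows are NESTED: `(RKNS)_k`-row ≤ `(RKNS³)_k`-row termwise

Support file (seat `prim-ineq-gen-7`, `--supports stmt-CriticalPhenomena-4575`). No definitions, no sorries.  Notation of `…NoHeavyLowerTailRKNS3`
(`N'_S = {S∪{o} ↮ R}`, `N⁺_S = {S∪{o,c} ↮ R}`, `N⁻_S = {S∪{o} ↮ R∪{c}}`, `F = {o ↔ S}`, `R = A ∖ S`).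
* `RKNSCompare.plus_ratio_ge`: `μ(N'∩F)·μ(N⁺) ≤ μ(N⁺∩F)·μ(N')` — BHK Thm 1.4 for the clusters of `S∪{o}` and `R`: given `N'`, `F` is negatively correlated
  with the `R`-side increasing event `{c ↔ some of R}`, and `N' ∖ {c ↔ some of R} = N⁺`;
* `RKNSCompare.minus_ratio_le`: `μ(N⁻∩F)·μ(N') ≤ μ(N'∩F)·μ(N⁻)` — BHK Thm 1.3 for the cluster of `S∪{o}`: given `N'`, `F` is positively correlated with
  `{c ↔ some of S∪{o}}`, and `N' ∖ {c ↔ some of S∪{o}} = N⁻`;  plus monotonicity `{o ↔ S} ⊆ {o ↔ S∪{c}}`.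
Hence `term_le`, `row_le`, `rkns3_row_nonneg_of_rkns_row_nonneg` (the hypothesis of `noHeavyLowerTail_of_rkns`, prove-4, implies that of
`noHeavyLowerTail_of_rkns3` instance by instance, so prove-4's bridge factors through `noHeavyLowerTail_of_rkns3`): `(RKNS³)_k` is the WEAKEST typed row of the family.
[cite: VandenbergHaggstromKahn2005, Thms. 1.3–1.4 (pp. 6–7)]
-/

namespace Summit.CriticalPhenomena.PercolationContinuityZ3.Theorems

open MeasureTheory Set Literature.Probability.LatticeModels Literature.Probability.Percolation

noncomputable section
open Classical

variable {n : ℕ}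

namespace RKNSCompare

/-- BHK 2006 Thm. 1.4 with ANY-reach events on both sides: `D = {S ↮ S'}`, `F = {O ↔ o}` (`O ⊆ S`), `G = {O' ↔ b}` (`O' ⊆ S'`):
`μ(D) μ(D ∩ F ∩ G) ≤ μ(D ∩ F) μ(D ∩ G)`. [cite: VandenbergHaggstromKahn2005, Thm. 1.4 (p. 7)] -/
theorem bhkTwo_any
    (hB2 : ∀ (n : ℕ) (w : Sym2 (Fin n) → unitInterval) (S S' : Finset (Fin n))
        (F G : Set (Sym2 (Fin n)) → ℝ), Monotone F → Monotone G → Disjoint S S' →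
        (prodBernoulli w).real
            {ω : BondConfig (Fin n) | ∀ s ∈ S, ∀ x ∈ S', ¬ (openGraph ω).Reachable s x} *
          (∫ ω in {ω : BondConfig (Fin n) | ∀ s ∈ S, ∀ x ∈ S', ¬ (openGraph ω).Reachable s x},
            F (⋃ s ∈ S, openEdgeCluster ω s) * G (⋃ s ∈ S', openEdgeCluster ω s)
              ∂(prodBernoulli w)) ≤
        (∫ ω in {ω : BondConfig (Fin n) | ∀ s ∈ S, ∀ x ∈ S', ¬ (openGraph ω).Reachable s x},
            F (⋃ s ∈ S, openEdgeCluster ω s) ∂(prodBernoulli w)) *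
          (∫ ω in {ω : BondConfig (Fin n) | ∀ s ∈ S, ∀ x ∈ S', ¬ (openGraph ω).Reachable s x},
            G (⋃ s ∈ S', openEdgeCluster ω s) ∂(prodBernoulli w)))
    (w : Sym2 (Fin n) → unitInterval) (S S' O O' : Finset (Fin n)) (hOS : O ⊆ S) (hO'S' : O' ⊆ S') (o b : Fin n)
    (hSS' : Disjoint S S') :
    (prodBernoulli w).real
          {ω : BondConfig (Fin n) | ∀ s ∈ S, ∀ x ∈ S', ¬ (openGraph ω).Reachable s x} *
        (prodBernoulli w).real
          ({ω : BondConfig (Fin n) | ∀ s ∈ S, ∀ x ∈ S', ¬ (openGraph ω).Reachable s x} ∩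
            ((⋃ s ∈ O, openConn s o) ∩ ⋃ s ∈ O', openConn s b)) ≤
      (prodBernoulli w).real
          ({ω : BondConfig (Fin n) | ∀ s ∈ S, ∀ x ∈ S', ¬ (openGraph ω).Reachable s x} ∩
            ⋃ s ∈ O, openConn s o) *
        (prodBernoulli w).real
          ({ω : BondConfig (Fin n) | ∀ s ∈ S, ∀ x ∈ S', ¬ (openGraph ω).Reachable s x} ∩
            ⋃ s ∈ O', openConn s b) := by
  have key := hB2 n w S S'
    ({C : Set (Sym2 (Fin n)) | ∃ s ∈ O, (openGraph C).Reachable s o}.indicator 1)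
    ({C : Set (Sym2 (Fin n)) | ∃ s ∈ O', (openGraph C).Reachable s b}.indicator 1)
    (knThm2_monotone_anyReach O o) (knThm2_monotone_anyReach O' b) hSS'
  simp only [knRef_anyReach_apply_sub S O hOS, knRef_anyReach_apply_sub S' O' hO'S'] at key
  have h := knThm2_setIntegral_indicator w
    {ω : BondConfig (Fin n) | ∀ s ∈ S, ∀ x ∈ S', ¬ (openGraph ω).Reachable s x}
    (⋃ s ∈ O, openConn s o) (⋃ s ∈ O', openConn s b)
  have h' := knThm2_setIntegral_indicator w
    {ω : BondConfig (Fin n) | ∀ s ∈ S, ∀ x ∈ S', ¬ (openGraph ω).Reachable s x}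
    (⋃ s ∈ O', openConn s b) (⋃ s ∈ O', openConn s b)
  rw [h.1, h'.1, h.2] at key
  exact key

/-- BHK 2006 Thm. 1.3 with two ANY-reach events of the same source set: `D = {S ↮ X}`, `F = {O₁ ↔ o}`, `H = {O₂ ↔ b}` (`O₁, O₂ ⊆ S`):
`μ(D ∩ F) μ(D ∩ H) ≤ μ(D) μ(D ∩ F ∩ H)`. [cite: VandenbergHaggstromKahn2005, Thm. 1.3 (p. 6)] -/
theorem bhkOne_any_any
    (hB1 : ∀ (n : ℕ) (w : Sym2 (Fin n) → unitInterval) (S : Finset (Fin n)) (X : Set (Fin n))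
        (F G : Set (Sym2 (Fin n)) → ℝ), Monotone F → Monotone G → (∀ s ∈ S, s ∉ X) →
        (∫ ω in {ω : BondConfig (Fin n) | ∀ s ∈ S, ∀ x ∈ X, ¬ (openGraph ω).Reachable s x},
            F (⋃ s ∈ S, openEdgeCluster ω s) ∂(prodBernoulli w)) *
          (∫ ω in {ω : BondConfig (Fin n) | ∀ s ∈ S, ∀ x ∈ X, ¬ (openGraph ω).Reachable s x},
            G (⋃ s ∈ S, openEdgeCluster ω s) ∂(prodBernoulli w)) ≤
        (prodBernoulli w).real
            {ω : BondConfig (Fin n) | ∀ s ∈ S, ∀ x ∈ X, ¬ (openGraph ω).Reachable s x} *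
          ∫ ω in {ω : BondConfig (Fin n) | ∀ s ∈ S, ∀ x ∈ X, ¬ (openGraph ω).Reachable s x},
            F (⋃ s ∈ S, openEdgeCluster ω s) * G (⋃ s ∈ S, openEdgeCluster ω s)
              ∂(prodBernoulli w))
    (w : Sym2 (Fin n) → unitInterval) (S O₁ O₂ : Finset (Fin n)) (h₁ : O₁ ⊆ S) (h₂ : O₂ ⊆ S) (X : Set (Fin n)) (o b : Fin n)
    (hSX : ∀ s ∈ S, s ∉ X) :
    (prodBernoulli w).real
          ({ω : BondConfig (Fin n) | ∀ s ∈ S, ∀ x ∈ X, ¬ (openGraph ω).Reachable s x} ∩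
            ⋃ s ∈ O₁, openConn s o) *
        (prodBernoulli w).real
          ({ω : BondConfig (Fin n) | ∀ s ∈ S, ∀ x ∈ X, ¬ (openGraph ω).Reachable s x} ∩
            ⋃ s ∈ O₂, openConn s b) ≤
      (prodBernoulli w).real
          {ω : BondConfig (Fin n) | ∀ s ∈ S, ∀ x ∈ X, ¬ (openGraph ω).Reachable s x} *
        (prodBernoulli w).real
          ({ω : BondConfig (Fin n) | ∀ s ∈ S, ∀ x ∈ X, ¬ (openGraph ω).Reachable s x} ∩
            ((⋃ s ∈ O₁, openConn s o) ∩ ⋃ s ∈ O₂, openConn s b)) := by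
  have key := hB1 n w S X
    ({C : Set (Sym2 (Fin n)) | ∃ s ∈ O₁, (openGraph C).Reachable s o}.indicator 1)
    ({C : Set (Sym2 (Fin n)) | ∃ s ∈ O₂, (openGraph C).Reachable s b}.indicator 1)
    (knThm2_monotone_anyReach O₁ o) (knThm2_monotone_anyReach O₂ b) hSX
  simp only [knRef_anyReach_apply_sub S O₁ h₁, knRef_anyReach_apply_sub S O₂ h₂] at key
  have h := knThm2_setIntegral_indicator w
    {ω : BondConfig (Fin n) | ∀ s ∈ S, ∀ x ∈ X, ¬ (openGraph ω).Reachable s x}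
    (⋃ s ∈ O₁, openConn s o) (⋃ s ∈ O₂, openConn s b)
  have h' := knThm2_setIntegral_indicator w
    {ω : BondConfig (Fin n) | ∀ s ∈ S, ∀ x ∈ X, ¬ (openGraph ω).Reachable s x}
    (⋃ s ∈ O₂, openConn s b) (⋃ s ∈ O₂, openConn s b)
  rw [h.1, h'.1, h.2] at key
  exact key

/-- `N' ∖ {c ↔ some of R} = N⁺` (also inside a further event `E`). [folklore] -/
theorem plus_sdiff_eq (A S : Finset (Fin n)) (o c : Fin n) (E : Set (BondConfig (Fin n))) :
    ({ω : BondConfig (Fin n) | ∀ s ∈ insert o S, ∀ x ∈ A \ S, ¬ (openGraph ω).Reachable s x} ∩ E) \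
        (⋃ x ∈ A \ S, (openConn x c : Set (BondConfig (Fin n)))) =
      {ω : BondConfig (Fin n) | ∀ s ∈ insert c (insert o S), ∀ x ∈ A \ S, ¬ (openGraph ω).Reachable s x} ∩ E := by
  ext ω
  simp only [mem_sdiff, mem_inter_iff, mem_setOf_eq, mem_iUnion, knThm2_mem_openConn, exists_prop, not_exists, not_and]
  constructor
  · rintro ⟨⟨hN, hE⟩, hno⟩
    refine ⟨fun s hs x hx => ?_, hE⟩
    rcases Finset.mem_insert.1 hs with rfl | hs'
    · exact fun h => hno x hx h.symm
    · exact hN s hs' x hx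
  · rintro ⟨hN, hE⟩
    exact ⟨⟨fun s hs x hx => hN s (Finset.mem_insert_of_mem hs) x hx, hE⟩,
      fun x hx h => hN c (Finset.mem_insert_self c _) x hx h.symm⟩

/-- `N' ∖ {c ↔ some of S∪{o}} = N⁻` (also inside a further event `E`). [folklore] -/
theorem minus_sdiff_eq (A S : Finset (Fin n)) (o c : Fin n) (E : Set (BondConfig (Fin n))) :
    ({ω : BondConfig (Fin n) | ∀ s ∈ insert o S, ∀ x ∈ A \ S, ¬ (openGraph ω).Reachable s x} ∩ E) \
        (⋃ s ∈ insert o S, (openConn s c : Set (BondConfig (Fin n)))) =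
      {ω : BondConfig (Fin n) | ∀ s ∈ insert o S, ∀ x ∈ insert c (A \ S), ¬ (openGraph ω).Reachable s x} ∩ E := by
  ext ω
  simp only [mem_sdiff, mem_inter_iff, mem_setOf_eq, mem_iUnion, knThm2_mem_openConn, exists_prop, not_exists, not_and]
  constructor
  · rintro ⟨⟨hN, hE⟩, hno⟩
    refine ⟨fun s hs x hx => ?_, hE⟩
    rcases Finset.mem_insert.1 hx with rfl | hx'
    · exact fun h => hno s hs h
    · exact hN s hs x hx'
  · rintro ⟨hN, hE⟩
    exact ⟨⟨fun s hs x hx => hN s hs x (Finset.mem_insert_of_mem hx), hE⟩,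
      fun s hs h => hN s hs c (Finset.mem_insert_self c _) h⟩

/-- **Plus ratio comparison** `μ(N'∩F)·μ(N⁺) ≤ μ(N⁺∩F)·μ(N')`, `F = {o ↔ S}` (needs `o, c ∉ A`, `o ≠ c`... only `o ∉ A`, `S ⊆ A`).
[cite: VandenbergHaggstromKahn2005, Thm. 1.4 (p. 7)] -/
theorem plus_ratio_ge (w : Sym2 (Fin n) → unitInterval) (A S : Finset (Fin n)) (o c : Fin n) (ho : o ∉ A) :
    (prodBernoulli w).real
        ({ω : BondConfig (Fin n) | ∀ s ∈ insert o S, ∀ x ∈ A \ S, ¬ (openGraph ω).Reachable s x} ∩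
          ⋃ s ∈ S, (openConn s o : Set (BondConfig (Fin n)))) *
      (prodBernoulli w).real
        {ω : BondConfig (Fin n) | ∀ s ∈ insert c (insert o S), ∀ x ∈ A \ S, ¬ (openGraph ω).Reachable s x} ≤
    (prodBernoulli w).real
        ({ω : BondConfig (Fin n) | ∀ s ∈ insert c (insert o S), ∀ x ∈ A \ S, ¬ (openGraph ω).Reachable s x} ∩
          ⋃ s ∈ S, (openConn s o : Set (BondConfig (Fin n)))) *
      (prodBernoulli w).real
        {ω : BondConfig (Fin n) | ∀ s ∈ insert o S, ∀ x ∈ A \ S, ¬ (openGraph ω).Reachable s x} := by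
  have hdisj : Disjoint (insert o S) (A \ S) := by
    rw [Finset.disjoint_left]
    intro s hs hs'
    rcases Finset.mem_insert.1 hs with rfl | hsS
    · exact ho (Finset.mem_sdiff.1 hs').1
    · exact (Finset.mem_sdiff.1 hs').2 hsS
  have key := bhkTwo_any stub_bhkSets.2 w (insert o S) (A \ S) S (A \ S) (Finset.subset_insert o S) subset_rfl o c hdisj
  set D := {ω : BondConfig (Fin n) | ∀ s ∈ insert o S, ∀ x ∈ A \ S, ¬ (openGraph ω).Reachable s x} with hD
  set F := (⋃ s ∈ S, (openConn s o : Set (BondConfig (Fin n)))) with hF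
  set G := (⋃ x ∈ A \ S, (openConn x c : Set (BondConfig (Fin n)))) with hG
  have hm : ∀ s : Set (BondConfig (Fin n)), MeasurableSet s := fun _ => MeasurableSet.of_discrete
  have h1 := measureReal_inter_add_sdiff (μ := prodBernoulli w) (s := D) (hm G) (h := measure_ne_top _ _)
  have h2 := measureReal_inter_add_sdiff (μ := prodBernoulli w) (s := D ∩ F) (hm G) (h := measure_ne_top _ _)
  have e1 : D \ G = {ω : BondConfig (Fin n) | ∀ s ∈ insert c (insert o S), ∀ x ∈ A \ S, ¬ (openGraph ω).Reachable s x} := by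
    simpa only [Set.inter_univ] using plus_sdiff_eq A S o c (Set.univ : Set (BondConfig (Fin n)))
  have e2 : (D ∩ F) \ G =
      {ω : BondConfig (Fin n) | ∀ s ∈ insert c (insert o S), ∀ x ∈ A \ S, ¬ (openGraph ω).Reachable s x} ∩ F :=
    plus_sdiff_eq A S o c F
  rw [e1] at h1; rw [e2] at h2; have hFG : D ∩ (F ∩ G) = D ∩ F ∩ G := (Set.inter_assoc D F G).symm
  rw [hFG] at key
  have hP : (prodBernoulli w).real
      {ω : BondConfig (Fin n) | ∀ s ∈ insert c (insert o S), ∀ x ∈ A \ S, ¬ (openGraph ω).Reachable s x} =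
      (prodBernoulli w).real D - (prodBernoulli w).real (D ∩ G) := by linarith
  have hA : (prodBernoulli w).real
      ({ω : BondConfig (Fin n) | ∀ s ∈ insert c (insert o S), ∀ x ∈ A \ S, ¬ (openGraph ω).Reachable s x} ∩ F) =
      (prodBernoulli w).real (D ∩ F) - (prodBernoulli w).real (D ∩ F ∩ G) := by linarith
  rw [hP, hA]; nlinarith [key]

/-- **Minus ratio comparison** `μ(N⁻∩F)·μ(N') ≤ μ(N'∩F)·μ(N⁻)`, `F = {o ↔ S}` (needs `o ∉ A`).
[cite: VandenbergHaggstromKahn2005, Thm. 1.3 (p. 6)] -/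
theorem minus_ratio_le (w : Sym2 (Fin n) → unitInterval) (A S : Finset (Fin n)) (o c : Fin n) (ho : o ∉ A) :
    (prodBernoulli w).real
        ({ω : BondConfig (Fin n) | ∀ s ∈ insert o S, ∀ x ∈ insert c (A \ S), ¬ (openGraph ω).Reachable s x} ∩
          ⋃ s ∈ S, (openConn s o : Set (BondConfig (Fin n)))) *
      (prodBernoulli w).real
        {ω : BondConfig (Fin n) | ∀ s ∈ insert o S, ∀ x ∈ A \ S, ¬ (openGraph ω).Reachable s x} ≤
    (prodBernoulli w).real
        ({ω : BondConfig (Fin n) | ∀ s ∈ insert o S, ∀ x ∈ A \ S, ¬ (openGraph ω).Reachable s x} ∩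
          ⋃ s ∈ S, (openConn s o : Set (BondConfig (Fin n)))) *
      (prodBernoulli w).real
        {ω : BondConfig (Fin n) | ∀ s ∈ insert o S, ∀ x ∈ insert c (A \ S), ¬ (openGraph ω).Reachable s x} := by
  have hSX : ∀ s ∈ insert o S, s ∉ (↑(A \ S) : Set (Fin n)) := by
    intro s hs
    rw [Finset.mem_coe, Finset.mem_sdiff]
    rcases Finset.mem_insert.1 hs with rfl | hsS
    · exact fun h => ho h.1
    · exact fun h => h.2 hsS
  have key := bhkOne_any_any stub_bhkSets.1 w (insert o S) S (insert o S) (Finset.subset_insert o S) subset_rfl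
    (↑(A \ S) : Set (Fin n)) o c hSX
  have hset : {ω : BondConfig (Fin n) | ∀ s ∈ insert o S, ∀ x ∈ (↑(A \ S) : Set (Fin n)), ¬ (openGraph ω).Reachable s x} =
      {ω : BondConfig (Fin n) | ∀ s ∈ insert o S, ∀ x ∈ A \ S, ¬ (openGraph ω).Reachable s x} := by ext ω; simp only [mem_setOf_eq, Finset.mem_coe]
  rw [hset] at key
  set D := {ω : BondConfig (Fin n) | ∀ s ∈ insert o S, ∀ x ∈ A \ S, ¬ (openGraph ω).Reachable s x} with hD
  set F := (⋃ s ∈ S, (openConn s o : Set (BondConfig (Fin n)))) with hF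
  set H := (⋃ s ∈ insert o S, (openConn s c : Set (BondConfig (Fin n)))) with hH
  have hm : ∀ s : Set (BondConfig (Fin n)), MeasurableSet s := fun _ => MeasurableSet.of_discrete
  have h1 := measureReal_inter_add_sdiff (μ := prodBernoulli w) (s := D) (hm H) (h := measure_ne_top _ _)
  have h2 := measureReal_inter_add_sdiff (μ := prodBernoulli w) (s := D ∩ F) (hm H) (h := measure_ne_top _ _)
  have e1 : D \ H = {ω : BondConfig (Fin n) | ∀ s ∈ insert o S, ∀ x ∈ insert c (A \ S), ¬ (openGraph ω).Reachable s x} := by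
    simpa only [Set.inter_univ] using minus_sdiff_eq A S o c (Set.univ : Set (BondConfig (Fin n)))
  have e2 : (D ∩ F) \ H =
      {ω : BondConfig (Fin n) | ∀ s ∈ insert o S, ∀ x ∈ insert c (A \ S), ¬ (openGraph ω).Reachable s x} ∩ F :=
    minus_sdiff_eq A S o c F
  rw [e1] at h1; rw [e2] at h2; have hFH : D ∩ (F ∩ H) = D ∩ F ∩ H := (Set.inter_assoc D F H).symm
  rw [hFH] at key
  have hP : (prodBernoulli w).real
      {ω : BondConfig (Fin n) | ∀ s ∈ insert o S, ∀ x ∈ insert c (A \ S), ¬ (openGraph ω).Reachable s x} =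
      (prodBernoulli w).real D - (prodBernoulli w).real (D ∩ H) := by linarith
  have hA : (prodBernoulli w).real
      ({ω : BondConfig (Fin n) | ∀ s ∈ insert o S, ∀ x ∈ insert c (A \ S), ¬ (openGraph ω).Reachable s x} ∩ F) =
      (prodBernoulli w).real (D ∩ F) - (prodBernoulli w).real (D ∩ F ∩ H) := by linarith
  rw [hP, hA]; nlinarith [key]

/-- Ratio–product arithmetic: from `a·Pp ≤ Ap·P`, `Ap ≤ App`, `0 ≤ m ≤ Pp` (and nonnegativity) conclude `(a/P)·m ≤ (App/Pp)·m`
(Lean's `x/0 = 0`; if `Pp = 0` then `m = 0`). [folklore] -/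
theorem ratio_mul_le {a P Ap App Pp m : ℝ} (hP : 0 ≤ P) (hPp : 0 ≤ Pp) (hm : 0 ≤ m) (hmP : m ≤ Pp)
    (hAp : 0 ≤ Ap) (hA : Ap ≤ App) (key : a * Pp ≤ Ap * P) : a / P * m ≤ App / Pp * m := by
  by_cases hPp0 : Pp = 0
  · have hm0 : m = 0 := le_antisymm (hPp0 ▸ hmP) hm
    simp [hm0]
  have hPp' : 0 < Pp := lt_of_le_of_ne hPp (Ne.symm hPp0)
  apply mul_le_mul_of_nonneg_right _ hm
  by_cases hP0 : P = 0
  · rw [hP0, div_zero]; exact div_nonneg (hAp.trans hA) hPp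
  have hP' : 0 < P := lt_of_le_of_ne hP (Ne.symm hP0)
  rw [div_le_div_iff₀ hP' hPp']
  nlinarith [key, mul_le_mul_of_nonneg_right hA hP]

/-- **Termwise comparison**: for `∅ ≠ S ⊆ A`, `o ∉ A`:
`(A_S/P_S)(m_S − m_R) ≤ (A⁺⁺_S/P⁺_S) m_S − (A⁻_S/P⁻_S) m_R`. [this file] -/
theorem term_le (w : Sym2 (Fin n) → unitInterval) (A S : Finset (Fin n)) (o c : Fin n) (ho : o ∉ A) (hS : S.Nonempty) :
    (prodBernoulli w).real
        ({ω : BondConfig (Fin n) | ∀ s ∈ insert o S, ∀ x ∈ A \ S, ¬ (openGraph ω).Reachable s x} ∩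
          ⋃ s ∈ S, (openConn s o : Set (BondConfig (Fin n)))) /
      (prodBernoulli w).real {ω : BondConfig (Fin n) | ∀ s ∈ insert o S, ∀ x ∈ A \ S, ¬ (openGraph ω).Reachable s x} *
      ((prodBernoulli w).real
          ({ω : BondConfig (Fin n) | ∀ s ∈ insert o S, ∀ x ∈ A \ S, ¬ (openGraph ω).Reachable s x} ∩
            ⋂ s ∈ S, (openConn s c : Set (BondConfig (Fin n)))) -
        (prodBernoulli w).real
          ({ω : BondConfig (Fin n) | ∀ s ∈ insert o S, ∀ x ∈ A \ S, ¬ (openGraph ω).Reachable s x} ∩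
            ⋂ x ∈ A \ S, (openConn x c : Set (BondConfig (Fin n))))) ≤
    (prodBernoulli w).real
        ({ω : BondConfig (Fin n) | ∀ s ∈ insert c (insert o S), ∀ x ∈ A \ S, ¬ (openGraph ω).Reachable s x} ∩
          ⋃ s ∈ insert c S, (openConn s o : Set (BondConfig (Fin n)))) /
      (prodBernoulli w).real {ω : BondConfig (Fin n) | ∀ s ∈ insert c (insert o S), ∀ x ∈ A \ S, ¬ (openGraph ω).Reachable s x} *
      (prodBernoulli w).real
          ({ω : BondConfig (Fin n) | ∀ s ∈ insert o S, ∀ x ∈ A \ S, ¬ (openGraph ω).Reachable s x} ∩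
            ⋂ s ∈ S, (openConn s c : Set (BondConfig (Fin n)))) -
    (prodBernoulli w).real
        ({ω : BondConfig (Fin n) | ∀ s ∈ insert o S, ∀ x ∈ insert c (A \ S), ¬ (openGraph ω).Reachable s x} ∩
          ⋃ s ∈ S, (openConn s o : Set (BondConfig (Fin n)))) /
      (prodBernoulli w).real {ω : BondConfig (Fin n) | ∀ s ∈ insert o S, ∀ x ∈ insert c (A \ S), ¬ (openGraph ω).Reachable s x} *
      (prodBernoulli w).real
          ({ω : BondConfig (Fin n) | ∀ s ∈ insert o S, ∀ x ∈ A \ S, ¬ (openGraph ω).Reachable s x} ∩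
            ⋂ x ∈ A \ S, (openConn x c : Set (BondConfig (Fin n)))) := by
  have hplus := plus_ratio_ge w A S o c ho
  have hminus := minus_ratio_le w A S o c ho
  have e1 := RKNS2.plus_inter_eq A S o c hS (Set.univ : Set (BondConfig (Fin n)))
  simp only [Set.univ_inter] at e1
  have hmS : (prodBernoulli w).real
        ({ω : BondConfig (Fin n) | ∀ s ∈ insert o S, ∀ x ∈ A \ S, ¬ (openGraph ω).Reachable s x} ∩
          ⋂ s ∈ S, (openConn s c : Set (BondConfig (Fin n)))) ≤
      (prodBernoulli w).real
        {ω : BondConfig (Fin n) | ∀ s ∈ insert c (insert o S), ∀ x ∈ A \ S, ¬ (openGraph ω).Reachable s x} := by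
    rw [e1]; exact measureReal_mono (h₂ := measure_ne_top _ _) inter_subset_left
  have hmR : (prodBernoulli w).real
        ({ω : BondConfig (Fin n) | ∀ s ∈ insert o S, ∀ x ∈ A \ S, ¬ (openGraph ω).Reachable s x} ∩
          ⋂ x ∈ A \ S, (openConn x c : Set (BondConfig (Fin n)))) ≤
      (prodBernoulli w).real
        {ω : BondConfig (Fin n) | ∀ s ∈ insert o S, ∀ x ∈ A \ S, ¬ (openGraph ω).Reachable s x} :=
    measureReal_mono (h₂ := measure_ne_top _ _) inter_subset_left
  have hApp : (prodBernoulli w).real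
        ({ω : BondConfig (Fin n) | ∀ s ∈ insert c (insert o S), ∀ x ∈ A \ S, ¬ (openGraph ω).Reachable s x} ∩
          ⋃ s ∈ S, (openConn s o : Set (BondConfig (Fin n)))) ≤
      (prodBernoulli w).real
        ({ω : BondConfig (Fin n) | ∀ s ∈ insert c (insert o S), ∀ x ∈ A \ S, ¬ (openGraph ω).Reachable s x} ∩
          ⋃ s ∈ insert c S, (openConn s o : Set (BondConfig (Fin n)))) := by
    refine measureReal_mono (h₂ := measure_ne_top _ _) (Set.inter_subset_inter_right _ ?_)
    exact Set.biUnion_subset_biUnion_left (fun s hs => Finset.mem_insert_of_mem hs)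
  have i1 := ratio_mul_le measureReal_nonneg measureReal_nonneg measureReal_nonneg hmS measureReal_nonneg hApp hplus
  have i2 := ratio_mul_le measureReal_nonneg measureReal_nonneg measureReal_nonneg hmR measureReal_nonneg le_rfl hminus
  rw [mul_sub]
  linarith

/-- **Row comparison**: `(RKNS)-row ≤ (RKNS³)-row` (same `Z` term; termwise `term_le` over `∅ ≠ S ⊆ A ∖ {z}`). [this file] -/
theorem row_le (w : Sym2 (Fin n) → unitInterval) (A : Finset (Fin n)) (o c z : Fin n) (ho : o ∉ A) :
    ∑ S ∈ (A.erase z).powerset.filter (fun S => S.Nonempty),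
      (prodBernoulli w).real
          ({ω : BondConfig (Fin n) | ∀ s ∈ insert o S, ∀ x ∈ A \ S, ¬ (openGraph ω).Reachable s x} ∩
            ⋃ s ∈ S, (openConn s o : Set (BondConfig (Fin n)))) /
        (prodBernoulli w).real {ω : BondConfig (Fin n) | ∀ s ∈ insert o S, ∀ x ∈ A \ S, ¬ (openGraph ω).Reachable s x} *
        ((prodBernoulli w).real
            ({ω : BondConfig (Fin n) | ∀ s ∈ insert o S, ∀ x ∈ A \ S, ¬ (openGraph ω).Reachable s x} ∩
              ⋂ s ∈ S, (openConn s c : Set (BondConfig (Fin n)))) -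
          (prodBernoulli w).real
            ({ω : BondConfig (Fin n) | ∀ s ∈ insert o S, ∀ x ∈ A \ S, ¬ (openGraph ω).Reachable s x} ∩
              ⋂ x ∈ A \ S, (openConn x c : Set (BondConfig (Fin n))))) +
      (prodBernoulli w).real ((⋃ a ∈ A, (openConn o a : Set (BondConfig (Fin n))))ᶜ ∩ (openConn z c)ᶜ) ≤
    ∑ S ∈ (A.erase z).powerset.filter (fun S => S.Nonempty),
      ((prodBernoulli w).real
          ({ω : BondConfig (Fin n) | ∀ s ∈ insert c (insert o S), ∀ x ∈ A \ S, ¬ (openGraph ω).Reachable s x} ∩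
            ⋃ s ∈ insert c S, (openConn s o : Set (BondConfig (Fin n)))) /
        (prodBernoulli w).real {ω : BondConfig (Fin n) | ∀ s ∈ insert c (insert o S), ∀ x ∈ A \ S, ¬ (openGraph ω).Reachable s x} *
        (prodBernoulli w).real
            ({ω : BondConfig (Fin n) | ∀ s ∈ insert o S, ∀ x ∈ A \ S, ¬ (openGraph ω).Reachable s x} ∩
              ⋂ s ∈ S, (openConn s c : Set (BondConfig (Fin n)))) -
      (prodBernoulli w).real
          ({ω : BondConfig (Fin n) | ∀ s ∈ insert o S, ∀ x ∈ insert c (A \ S), ¬ (openGraph ω).Reachable s x} ∩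
            ⋃ s ∈ S, (openConn s o : Set (BondConfig (Fin n)))) /
        (prodBernoulli w).real {ω : BondConfig (Fin n) | ∀ s ∈ insert o S, ∀ x ∈ insert c (A \ S), ¬ (openGraph ω).Reachable s x} *
        (prodBernoulli w).real
            ({ω : BondConfig (Fin n) | ∀ s ∈ insert o S, ∀ x ∈ A \ S, ¬ (openGraph ω).Reachable s x} ∩
              ⋂ x ∈ A \ S, (openConn x c : Set (BondConfig (Fin n))))) +
      (prodBernoulli w).real ((⋃ a ∈ A, (openConn o a : Set (BondConfig (Fin n))))ᶜ ∩ (openConn z c)ᶜ) := by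
  refine add_le_add (Finset.sum_le_sum fun S hSm => ?_) le_rfl
  rw [Finset.mem_filter] at hSm
  exact term_le w A S o c ho hSm.2

end RKNSCompare

/-- **`(RKNS)_k ⟹ (RKNS³)_k` pointwise**: at every `(n, w, A, o, c, z)` with `o ∉ A`, nonnegativity of the refined row of
`noHeavyLowerTail_of_rkns` implies nonnegativity of the fully-refined row of `noHeavyLowerTail_of_rkns3`; hence the typed crux target
`(RKNS³)_k` is the weaker hypothesis. [this file] -/
theorem rkns3_row_nonneg_of_rkns_row_nonneg (w : Sym2 (Fin n) → unitInterval) (A : Finset (Fin n)) (o c z : Fin n) (ho : o ∉ A)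
    (hR : 0 ≤ ∑ S ∈ (A.erase z).powerset.filter (fun S => S.Nonempty),
      (prodBernoulli w).real
          ({ω : BondConfig (Fin n) | ∀ s ∈ insert o S, ∀ x ∈ A \ S, ¬ (openGraph ω).Reachable s x} ∩
            ⋃ s ∈ S, (openConn s o : Set (BondConfig (Fin n)))) /
        (prodBernoulli w).real {ω : BondConfig (Fin n) | ∀ s ∈ insert o S, ∀ x ∈ A \ S, ¬ (openGraph ω).Reachable s x} *
        ((prodBernoulli w).real
            ({ω : BondConfig (Fin n) | ∀ s ∈ insert o S, ∀ x ∈ A \ S, ¬ (openGraph ω).Reachable s x} ∩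
              ⋂ s ∈ S, (openConn s c : Set (BondConfig (Fin n)))) -
          (prodBernoulli w).real
            ({ω : BondConfig (Fin n) | ∀ s ∈ insert o S, ∀ x ∈ A \ S, ¬ (openGraph ω).Reachable s x} ∩
              ⋂ x ∈ A \ S, (openConn x c : Set (BondConfig (Fin n))))) +
      (prodBernoulli w).real ((⋃ a ∈ A, (openConn o a : Set (BondConfig (Fin n))))ᶜ ∩ (openConn z c)ᶜ)) :
    0 ≤ ∑ S ∈ (A.erase z).powerset.filter (fun S => S.Nonempty),
      ((prodBernoulli w).real
          ({ω : BondConfig (Fin n) | ∀ s ∈ insert c (insert o S), ∀ x ∈ A \ S, ¬ (openGraph ω).Reachable s x} ∩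
            ⋃ s ∈ insert c S, (openConn s o : Set (BondConfig (Fin n)))) /
        (prodBernoulli w).real {ω : BondConfig (Fin n) | ∀ s ∈ insert c (insert o S), ∀ x ∈ A \ S, ¬ (openGraph ω).Reachable s x} *
        (prodBernoulli w).real
            ({ω : BondConfig (Fin n) | ∀ s ∈ insert o S, ∀ x ∈ A \ S, ¬ (openGraph ω).Reachable s x} ∩
              ⋂ s ∈ S, (openConn s c : Set (BondConfig (Fin n)))) -
      (prodBernoulli w).real
          ({ω : BondConfig (Fin n) | ∀ s ∈ insert o S, ∀ x ∈ insert c (A \ S), ¬ (openGraph ω).Reachable s x} ∩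
            ⋃ s ∈ S, (openConn s o : Set (BondConfig (Fin n)))) /
        (prodBernoulli w).real {ω : BondConfig (Fin n) | ∀ s ∈ insert o S, ∀ x ∈ insert c (A \ S), ¬ (openGraph ω).Reachable s x} *
        (prodBernoulli w).real
            ({ω : BondConfig (Fin n) | ∀ s ∈ insert o S, ∀ x ∈ A \ S, ¬ (openGraph ω).Reachable s x} ∩
              ⋂ x ∈ A \ S, (openConn x c : Set (BondConfig (Fin n))))) +
      (prodBernoulli w).real ((⋃ a ∈ A, (openConn o a : Set (BondConfig (Fin n))))ᶜ ∩ (openConn z c)ᶜ) :=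
  hR.trans (RKNSCompare.row_le w A o c z ho)

end

end Summit.CriticalPhenomena.PercolationContinuityZ3.Theorems
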